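import Summits.BirchSwinnertonDyer.BirchSwinnertonDyer.Theorems.KimAtThreeSemiLocalTraceDualTwistLocal
import HarnessLib

/-!
# Route `KimAtThreeKolyvagin` (W2): the twisted trace duals PER COMPLETION — in `L_𝔓 = ℚ(ζ_m)_𝔓`
# (`𝔓 ∣ p ∤ m`), the dual of the Euler-factor lattice `P_φ⁻¹·𝒪_𝔓` is `P_{φ⁻¹}·𝒪_𝔓`

Cell `bsd-addord`, seat `bsd-addord-w2-acc3` (PROGRAMME PART 1b row (3), gen 6); ninth file of the
trace-duality set; `--supports stmt-BirchSwinnertonDyer-19679` (helper).  TOOL theorems only (no definition,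
no named fact, no instance, no `sorry`); pure algebra of `ℚ(ζ_m)`; nothing about any curve.

WHY.  Seat w2-c4 gen 9's LATTICE LEMMA (memo W2C4-ANOMALOUS-PORT-g9 §2 (d)) is a statement inside ONE
unramified local field `K = L_𝔓`: «`log_ω(E(K) ⊗ ℤ_p) = E_p(φ)⁻¹·𝒪_K`, hence by trace duality
`exp*_ω(H¹(K,T)) = E_p(φ⁻¹)·𝒪_K`», `E_p(X) = (p − a_pX + X²)/p`, `φ` the arithmetic Frobenius; and the
single-completion packages of crux 19560 (`hKdef₀` / `hLog₀`, seats acc5 · kim3 · acc4) read the dual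
exponential and the log-lattice in ONE completion `L_{w₀}`.  The companion files proved the duality
SEMI-LOCALLY (`KimAtThreeSemiLocalTraceDualTwistEuler`: `(P_u⁻¹L_int)^∨ = P_{u⁻¹}·L_int`) and the
per-factor reading of the twist (`KimAtThreeSemiLocalTraceDualTwistLocal`: `σ_{[p]}` fixes every `𝔓 ∣ p`,
`Ψ(P_u·v)_𝔓 = p·x − a·S x + S²x`).  This file puts them together INSIDE `L_𝔓`: with `u ≡ p`, `w·[p] = 1`
(`σ_u = φ`, `σ_w = φ⁻¹` on `L_𝔓` via `GaloisActionPlaces.galAdicCompletionMap`) and the local operators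
`P_u^loc o = p·o − a·φ o + φ² o`, `P_w^loc z = p·z − a·φ⁻¹ z + φ⁻² z`:

* §1 plumbing: `norm_le_one_iff_adicCompletionEquiv_mem` (`‖t‖ ≤ 1 ↔ e_p t ∈ 𝒪_v`),
  `trace_mul_symm_single` (`Tr((x · Ψ⁻¹(y at 𝔓₀))) = e_p⁻¹ Tr_{𝔓₀}(Ψ(x)_{𝔓₀} · y)`),
  `eulerTwist_mem_cycIntLattice_iff_forall_of_smul_eq` (membership factor by factor for ANY twist index
  stabilising the places — the companion's lemma un-keyed from `w·[p] = 1`), `eulerTwistLoc_zero`.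
* §2 ★★ `forall_trace_eulerTwistLoc_mul_mem_iff` — **`(P_w^loc·𝒪_𝔓)^∨ = (P_u^loc)⁻¹𝒪_𝔓`**:
  `Tr_{L_𝔓/ℚ_v}((P_w^loc o)·y) ∈ 𝒪_v ∀ o ∈ 𝒪_𝔓 ↔ P_u^loc y ∈ 𝒪_𝔓` (`p ∤ m`, any `a`).
* (companion `KimAtThreeSemiLocalTraceDualTwistLocalLattice`: ★★★ `((P_u^loc)⁻¹𝒪_𝔓)^∨ = P_w^loc·𝒪_𝔓`
  and its `p`-scaled form `(E_p(φ)⁻¹𝒪_𝔓)^∨ = E_p(φ⁻¹)𝒪_𝔓`, `a ≠ ±(p+1)`.)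

HONEST LIMITS: pure algebra; the identification `log_ω(E(L_𝔓) ⊗ ℤ_p) = E_p(φ)⁻¹𝒪_𝔓` (formal groups +
`#Ẽ(k)[p^∞]`) and the pairing `Tr(exp*_ω · log_ω) ∈ ℤ_p` are NOT here; `(σ_u)_𝔓` is the transport of
Kato's `σ_u`, a Frobenius AT `𝔓` by `σ_u x ≡ x^p (mod 𝔓)` (companion file), not a separately named local
Frobenius.

References: [Kim2022StructureSelmer] Lemma 3.4, Cor. 3.5, §3.4.1; [Kato2004Asterisque] (5.7.1), §9.4;
[BlochKato1990] Prop. 3.8; [CasselsFrohlichANT1967] Ch. II §10–§11, Ch. VII §1.1; [Washington1997] Thm. 2.13.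
-/

set_option autoImplicit false
-- the Theorems namespace of a single-conjunct summit repeats the summit name by design (D-0017)
set_option linter.dupNamespace false
-- `CyclotomicField m ℚ`'s two `ℚ`-algebra structures agree only up to unfolding (as in the sibling files)
set_option backward.isDefEq.respectTransparency false

noncomputable section

open scoped TensorProduct NumberField BigOperators Pointwise
open NumberField IsDedekindDomain
open Literature.NumberTheory.EllipticCurves Literature.NumberTheory.EllipticCurves.Kato2004.EulerSystemValues
open Literature.NumberTheory.Automorphic Literature.NumberTheory.AdelicBaseChange
open Summit.BirchSwinnertonDyer.Rank1Residual.GaloisImage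
open Summit.BirchSwinnertonDyer.BirchSwinnertonDyer.Theorems.KimAtThreePortSharedSATCore
open Summit.BirchSwinnertonDyer.BirchSwinnertonDyer.Theorems.KimAtThreeSemiLocalTraceDualTwist
open Summit.BirchSwinnertonDyer.BirchSwinnertonDyer.Theorems.KimAtThreeSemiLocalTraceDualTwistEuler
open Summit.BirchSwinnertonDyer.BirchSwinnertonDyer.Theorems.KimAtThreeSemiLocalTraceDualTwistLocal

namespace Summit.BirchSwinnertonDyer.BirchSwinnertonDyer.Theorems.KimAtThreeSemiLocalTraceDualTwistLocalDual

variable (m : ℕ) [NeZero m] (p : ℕ) [Fact p.Prime]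

/-! ### §1 Plumbing: `p`-adic integrality through `e_p`, traces against a family supported at one place -/

omit [NeZero m] in
/-- `‖t‖ ≤ 1 ↔ e_p(t) ∈ 𝒪_v` for `t ∈ ℚ_p` and Mathlib's `e_p : ℚ_p ≃ ℚ_v`. [folklore] -/
theorem norm_le_one_iff_adicCompletionEquiv_mem (t : ℚ_[p]) :
    ‖t‖ ≤ 1 ↔ Padic.adicCompletionEquiv (𝓞 ℚ) ⟨p, Fact.out⟩ t ∈
      (((Rat.HeightOneSpectrum.primesEquiv (R := 𝓞 ℚ)).symm ⟨p, Fact.out⟩).adicCompletionIntegers ℚ) := by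
  constructor
  · intro ht
    obtain ⟨r, hr⟩ := exists_padicInt_coe_eq_of_norm_le_one (p := p) ht
    rw [← hr, ← PadicInt.coe_adicCompletionIntegersEquiv_apply]
    exact (PadicInt.adicCompletionIntegersEquiv (𝓞 ℚ) ⟨p, Fact.out⟩ r).2
  · intro ht
    have hts : t = ((PadicInt.adicCompletionIntegersEquiv (𝓞 ℚ) ⟨p, Fact.out⟩).symm ⟨_, ht⟩ : ℤ_[p]) := by
      rw [PadicInt.coe_adicCompletionIntegersEquiv_symm_apply]
      exact ((Padic.adicCompletionEquiv (𝓞 ℚ) ⟨p, Fact.out⟩).symm_apply_apply t).symm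
    rw [hts]
    exact PadicInt.norm_le_one _

omit [NeZero m] in
/-- **Traces against a family supported at one place**: for w2-acc4's `Ψ` and `y ∈ L_{𝔓₀}`,
`e_p(Tr_{(ℚ_p ⊗ ℚ(ζ_m))/ℚ_p}(x · Ψ⁻¹(y at 𝔓₀, 0 elsewhere))) = Tr_{L_{𝔓₀}/ℚ_v}(Ψ(x)_{𝔓₀} · y)`
(`Tr = Σ_𝔓 Tr_𝔓 ∘ Ψ`, w2-acc4's `padicTensor_trace`). [cite: CasselsFrohlichANT1967, Ch. II §10 Theorem (10.2)] -/
theorem trace_mul_symm_single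
    [Fintype (((Rat.HeightOneSpectrum.primesEquiv (R := 𝓞 ℚ)).symm ⟨p, Fact.out⟩).Extension
      (𝓞 (CyclotomicField m ℚ)))]
    [DecidableEq (((Rat.HeightOneSpectrum.primesEquiv (R := 𝓞 ℚ)).symm ⟨p, Fact.out⟩).Extension
      (𝓞 (CyclotomicField m ℚ)))]
    (Ψ : ℚ_[p] ⊗[ℚ] CyclotomicField m ℚ ≃ₐ[ℚ]
      (Π 𝔓 : ((Rat.HeightOneSpectrum.primesEquiv (R := 𝓞 ℚ)).symm ⟨p, Fact.out⟩).Extension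
        (𝓞 (CyclotomicField m ℚ)), 𝔓.1.adicCompletion (CyclotomicField m ℚ)))
    (hΨ : ∀ (s : ℚ_[p]) (x : CyclotomicField m ℚ)
      (𝔓 : ((Rat.HeightOneSpectrum.primesEquiv (R := 𝓞 ℚ)).symm ⟨p, Fact.out⟩).Extension
        (𝓞 (CyclotomicField m ℚ))),
      Ψ (s ⊗ₜ[ℚ] x) 𝔓 = algebraMap (CyclotomicField m ℚ) (𝔓.1.adicCompletion (CyclotomicField m ℚ)) x *
        algebraMap (((Rat.HeightOneSpectrum.primesEquiv (R := 𝓞 ℚ)).symm ⟨p, Fact.out⟩).adicCompletion ℚ)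
          (𝔓.1.adicCompletion (CyclotomicField m ℚ)) (Padic.adicCompletionEquiv (𝓞 ℚ) ⟨p, Fact.out⟩ s))
    (𝔓₀ : ((Rat.HeightOneSpectrum.primesEquiv (R := 𝓞 ℚ)).symm ⟨p, Fact.out⟩).Extension
      (𝓞 (CyclotomicField m ℚ)))
    (y : 𝔓₀.1.adicCompletion (CyclotomicField m ℚ)) (x : ℚ_[p] ⊗[ℚ] CyclotomicField m ℚ) :
    Padic.adicCompletionEquiv (𝓞 ℚ) ⟨p, Fact.out⟩
        (Algebra.trace ℚ_[p] (ℚ_[p] ⊗[ℚ] CyclotomicField m ℚ)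
          (x * Ψ.symm (Pi.single (M := fun 𝔓 : ((Rat.HeightOneSpectrum.primesEquiv (R := 𝓞 ℚ)).symm
              ⟨p, Fact.out⟩).Extension (𝓞 (CyclotomicField m ℚ)) => 𝔓.1.adicCompletion (CyclotomicField m ℚ))
            𝔓₀ y))) =
      Algebra.trace (((Rat.HeightOneSpectrum.primesEquiv (R := 𝓞 ℚ)).symm ⟨p, Fact.out⟩).adicCompletion ℚ)
        (𝔓₀.1.adicCompletion (CyclotomicField m ℚ)) (Ψ x 𝔓₀ * y) := by
  rw [padicTensor_trace Ψ hΨ, map_mul, AlgEquiv.apply_symm_apply,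
    Fintype.sum_eq_single 𝔓₀ (fun 𝔓 h𝔓 => by rw [Pi.mul_apply, Pi.single_eq_of_ne h𝔓, mul_zero, map_zero]),
    Pi.mul_apply, Pi.single_eq_same]

omit [NeZero m] [Fact p.Prime] in
/-- The local Euler operator `x ↦ p·x − a·S x + S(S x)` of a ring map `S` kills `0`. [folklore] -/
theorem eulerTwistLoc_zero {R : Type*} [Ring R] (S : R →+* R) (a : ℤ) :
    (p : R) * 0 - (a : R) * S 0 + S (S 0) = 0 := by
  rw [map_zero, map_zero, mul_zero, mul_zero, sub_zero, zero_add]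

/-- **`P_u·v ∈ L_int` factor by factor, for ANY twist index `u` stabilising the places above `p`**
(`p ∤ m`; the companion's `eulerTwist_mem_cycIntLattice_iff_forall` un-keyed from `w·[p] = 1`, so that it
serves `u ≡ p` — the Frobenius itself — as well). [cite: CasselsFrohlichANT1967, Ch. II §10 Theorem (10.2) and Ch. VII §1.1] -/
theorem eulerTwist_mem_cycIntLattice_iff_forall_of_smul_eq (hpm : ¬ p ∣ m)
    (Ψ : ℚ_[p] ⊗[ℚ] CyclotomicField m ℚ ≃ₐ[ℚ]
      (Π 𝔓 : ((Rat.HeightOneSpectrum.primesEquiv (R := 𝓞 ℚ)).symm ⟨p, Fact.out⟩).Extension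
        (𝓞 (CyclotomicField m ℚ)), 𝔓.1.adicCompletion (CyclotomicField m ℚ)))
    (hΨ : ∀ (s : ℚ_[p]) (x : CyclotomicField m ℚ)
      (𝔓 : ((Rat.HeightOneSpectrum.primesEquiv (R := 𝓞 ℚ)).symm ⟨p, Fact.out⟩).Extension
        (𝓞 (CyclotomicField m ℚ))),
      Ψ (s ⊗ₜ[ℚ] x) 𝔓 = algebraMap (CyclotomicField m ℚ) (𝔓.1.adicCompletion (CyclotomicField m ℚ)) x *
        algebraMap (((Rat.HeightOneSpectrum.primesEquiv (R := 𝓞 ℚ)).symm ⟨p, Fact.out⟩).adicCompletion ℚ)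
          (𝔓.1.adicCompletion (CyclotomicField m ℚ)) (Padic.adicCompletionEquiv (𝓞 ℚ) ⟨p, Fact.out⟩ s))
    (u : (ZMod m)ˣ)
    (hu : ∀ 𝔓 : ((Rat.HeightOneSpectrum.primesEquiv (R := 𝓞 ℚ)).symm ⟨p, Fact.out⟩).Extension
      (𝓞 (CyclotomicField m ℚ)), sigma m u • 𝔓.1 = 𝔓.1) (a : ℤ)
    (v : ℚ_[p] ⊗[ℚ] CyclotomicField m ℚ) :
    ∑ g : (ZMod m)ˣ, (((((p : ℕ) : MonoidAlgebra ℤ_[p] (ZMod m)ˣ) -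
        MonoidAlgebra.single u (a : ℤ_[p]) + MonoidAlgebra.single (u ^ 2) (1 : ℤ_[p])).coeff g :
          ℤ_[p]) : ℚ_[p]) • Algebra.TensorProduct.map (AlgHom.id ℚ ℚ_[p])
            (sigma m g : CyclotomicField m ℚ →ₐ[ℚ] CyclotomicField m ℚ) v ∈ cycIntLattice p m ↔
    ∀ 𝔓 : ((Rat.HeightOneSpectrum.primesEquiv (R := 𝓞 ℚ)).symm ⟨p, Fact.out⟩).Extension
        (𝓞 (CyclotomicField m ℚ)),
      (p : 𝔓.1.adicCompletion (CyclotomicField m ℚ)) * Ψ v 𝔓 -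
        (a : 𝔓.1.adicCompletion (CyclotomicField m ℚ)) * galAdicCompletionMap (sigma m u) (hu 𝔓) (Ψ v 𝔓) +
        galAdicCompletionMap (sigma m u) (hu 𝔓) (galAdicCompletionMap (sigma m u) (hu 𝔓) (Ψ v 𝔓)) ∈
        𝔓.1.adicCompletionIntegers (CyclotomicField m ℚ) := by
  rw [mem_cycIntLattice_iff_forall_padicTensor_mem m p hpm Ψ hΨ]
  refine forall_congr' fun 𝔓 => ?_
  have h := padicTensor_eulerTwist_apply m p (Ψ : ℚ_[p] ⊗[ℚ] CyclotomicField m ℚ →ₐ[ℚ] _) hΨ u a 𝔓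
    (hu 𝔓) v
  exact Iff.of_eq (congrArg (fun z => z ∈ 𝔓.1.adicCompletionIntegers (CyclotomicField m ℚ)) h)

/-- A family supported at one place with an integral entry pulls back INTO `L_int` (`p ∤ m`). [folklore] -/
theorem symm_single_mem_cycIntLattice (hpm : ¬ p ∣ m)
    [DecidableEq (((Rat.HeightOneSpectrum.primesEquiv (R := 𝓞 ℚ)).symm ⟨p, Fact.out⟩).Extension
      (𝓞 (CyclotomicField m ℚ)))]
    (Ψ : ℚ_[p] ⊗[ℚ] CyclotomicField m ℚ ≃ₐ[ℚ]
      (Π 𝔓 : ((Rat.HeightOneSpectrum.primesEquiv (R := 𝓞 ℚ)).symm ⟨p, Fact.out⟩).Extension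
        (𝓞 (CyclotomicField m ℚ)), 𝔓.1.adicCompletion (CyclotomicField m ℚ)))
    (hΨ : ∀ (s : ℚ_[p]) (x : CyclotomicField m ℚ)
      (𝔓 : ((Rat.HeightOneSpectrum.primesEquiv (R := 𝓞 ℚ)).symm ⟨p, Fact.out⟩).Extension
        (𝓞 (CyclotomicField m ℚ))),
      Ψ (s ⊗ₜ[ℚ] x) 𝔓 = algebraMap (CyclotomicField m ℚ) (𝔓.1.adicCompletion (CyclotomicField m ℚ)) x *
        algebraMap (((Rat.HeightOneSpectrum.primesEquiv (R := 𝓞 ℚ)).symm ⟨p, Fact.out⟩).adicCompletion ℚ)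
          (𝔓.1.adicCompletion (CyclotomicField m ℚ)) (Padic.adicCompletionEquiv (𝓞 ℚ) ⟨p, Fact.out⟩ s))
    (𝔓₀ : ((Rat.HeightOneSpectrum.primesEquiv (R := 𝓞 ℚ)).symm ⟨p, Fact.out⟩).Extension
      (𝓞 (CyclotomicField m ℚ)))
    {o : 𝔓₀.1.adicCompletion (CyclotomicField m ℚ)} (ho : o ∈ 𝔓₀.1.adicCompletionIntegers (CyclotomicField m ℚ)) :
    Ψ.symm (Pi.single (M := fun 𝔓 : ((Rat.HeightOneSpectrum.primesEquiv (R := 𝓞 ℚ)).symm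
        ⟨p, Fact.out⟩).Extension (𝓞 (CyclotomicField m ℚ)) => 𝔓.1.adicCompletion (CyclotomicField m ℚ)) 𝔓₀ o) ∈
      cycIntLattice p m := by
  rw [mem_cycIntLattice_iff_forall_padicTensor_mem m p hpm Ψ hΨ]
  intro 𝔓
  rw [AlgEquiv.apply_symm_apply]
  by_cases h𝔓 : 𝔓 = 𝔓₀
  · subst h𝔓; rw [Pi.single_eq_same]; exact ho
  · rw [Pi.single_eq_of_ne h𝔓]; exact zero_mem _

/-! ### §2 `(P_w^loc·𝒪_𝔓)^∨ = (P_u^loc)⁻¹𝒪_𝔓` -/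

/-- ★★ **`(P_w^loc·𝒪_{𝔓₀})^∨ = (P_u^loc)⁻¹𝒪_{𝔓₀}`** (`p ∤ m`, `u ≡ p`, `w·[p] = 1`, any `a`): for
`y ∈ L_{𝔓₀}`, `Tr_{L_{𝔓₀}/ℚ_v}((p·o − a·φ⁻¹o + φ⁻²o)·y) ∈ 𝒪_v` for every `o ∈ 𝒪_{𝔓₀}` iff
`p·y − a·φ y + φ² y ∈ 𝒪_{𝔓₀}` (`φ := (σ_u)_{𝔓₀}`, `φ⁻¹ := (σ_w)_{𝔓₀}`).  From the semi-local
`forall_norm_trace_eulerTwist_mul_le_one_iff` on the family `y at 𝔓₀`, read factor by factor.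
[cite: Kim2022StructureSelmer, §3.4.1 and the proof of Thm. 3.13 (arXiv v3 pp. 26–28)] -/
theorem forall_trace_eulerTwistLoc_mul_mem_iff (hpm : ¬ p ∣ m)
    [Fintype (((Rat.HeightOneSpectrum.primesEquiv (R := 𝓞 ℚ)).symm ⟨p, Fact.out⟩).Extension
      (𝓞 (CyclotomicField m ℚ)))]
    (u w : (ZMod m)ˣ) (hu : (u : ZMod m) = (p : ZMod m)) (hw : (w : ZMod m) * ((p : ℕ) : ZMod m) = 1)
    (a : ℤ)
    (𝔓₀ : ((Rat.HeightOneSpectrum.primesEquiv (R := 𝓞 ℚ)).symm ⟨p, Fact.out⟩).Extension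
      (𝓞 (CyclotomicField m ℚ)))
    (y : 𝔓₀.1.adicCompletion (CyclotomicField m ℚ)) :
    (∀ o ∈ 𝔓₀.1.adicCompletionIntegers (CyclotomicField m ℚ),
      Algebra.trace (((Rat.HeightOneSpectrum.primesEquiv (R := 𝓞 ℚ)).symm ⟨p, Fact.out⟩).adicCompletion ℚ)
          (𝔓₀.1.adicCompletion (CyclotomicField m ℚ))
          (((p : 𝔓₀.1.adicCompletion (CyclotomicField m ℚ)) * o -
            (a : 𝔓₀.1.adicCompletion (CyclotomicField m ℚ)) *
              galAdicCompletionMap (sigma m w) (sigma_smul_eq_self_of_mul_coe_eq_one m p hpm w hw 𝔓₀) o +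
            galAdicCompletionMap (sigma m w) (sigma_smul_eq_self_of_mul_coe_eq_one m p hpm w hw 𝔓₀)
              (galAdicCompletionMap (sigma m w) (sigma_smul_eq_self_of_mul_coe_eq_one m p hpm w hw 𝔓₀) o)) *
            y) ∈
        (((Rat.HeightOneSpectrum.primesEquiv (R := 𝓞 ℚ)).symm ⟨p, Fact.out⟩).adicCompletionIntegers ℚ)) ↔
    (p : 𝔓₀.1.adicCompletion (CyclotomicField m ℚ)) * y -
        (a : 𝔓₀.1.adicCompletion (CyclotomicField m ℚ)) *
          galAdicCompletionMap (sigma m u) (sigma_smul_eq_self_of_coe_eq m p hpm u hu 𝔓₀) y +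
        galAdicCompletionMap (sigma m u) (sigma_smul_eq_self_of_coe_eq m p hpm u hu 𝔓₀)
          (galAdicCompletionMap (sigma m u) (sigma_smul_eq_self_of_coe_eq m p hpm u hu 𝔓₀) y) ∈
      𝔓₀.1.adicCompletionIntegers (CyclotomicField m ℚ) := by
  classical
  obtain ⟨Ψ, hΨ⟩ := exists_padicTensorAlgEquiv (CyclotomicField m ℚ) p
  -- `w⁻¹ ≡ p`, so `σ_{w⁻¹} = σ_u` stabilises every place
  have hu' : ((w⁻¹ : (ZMod m)ˣ) : ZMod m) = (p : ZMod m) := Units.inv_eq_of_mul_eq_one_right hw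
  have hwu : sigma m w⁻¹ = sigma m u := congrArg (sigma m) (Units.ext (hu'.trans hu.symm))
  have hst : ∀ 𝔓 : ((Rat.HeightOneSpectrum.primesEquiv (R := 𝓞 ℚ)).symm ⟨p, Fact.out⟩).Extension
      (𝓞 (CyclotomicField m ℚ)), sigma m w⁻¹ • 𝔓.1 = 𝔓.1 :=
    fun 𝔓 => sigma_smul_eq_self_of_coe_eq m p hpm w⁻¹ hu' 𝔓
  -- the family `Y = (y at 𝔓₀, 0 elsewhere)`
  set Y : ℚ_[p] ⊗[ℚ] CyclotomicField m ℚ := Ψ.symm (Pi.single (M := fun 𝔓 :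
      ((Rat.HeightOneSpectrum.primesEquiv (R := 𝓞 ℚ)).symm ⟨p, Fact.out⟩).Extension
        (𝓞 (CyclotomicField m ℚ)) => 𝔓.1.adicCompletion (CyclotomicField m ℚ)) 𝔓₀ y) with hYdef
  have hY : ∀ 𝔓, Ψ Y 𝔓 = Pi.single (M := fun 𝔓 :
      ((Rat.HeightOneSpectrum.primesEquiv (R := 𝓞 ℚ)).symm ⟨p, Fact.out⟩).Extension
        (𝓞 (CyclotomicField m ℚ)) => 𝔓.1.adicCompletion (CyclotomicField m ℚ)) 𝔓₀ y 𝔓 := by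
    intro 𝔓; rw [hYdef, AlgEquiv.apply_symm_apply]
  -- the twist `P_w` read at `𝔓₀`
  have hPw : ∀ x : ℚ_[p] ⊗[ℚ] CyclotomicField m ℚ,
      Ψ (∑ g : (ZMod m)ˣ, (((((p : ℕ) : MonoidAlgebra ℤ_[p] (ZMod m)ˣ) -
        MonoidAlgebra.single w (a : ℤ_[p]) + MonoidAlgebra.single (w ^ 2) (1 : ℤ_[p])).coeff g :
          ℤ_[p]) : ℚ_[p]) • Algebra.TensorProduct.map (AlgHom.id ℚ ℚ_[p])
            (sigma m g : CyclotomicField m ℚ →ₐ[ℚ] CyclotomicField m ℚ) x) 𝔓₀ =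
      (p : 𝔓₀.1.adicCompletion (CyclotomicField m ℚ)) * Ψ x 𝔓₀ -
        (a : 𝔓₀.1.adicCompletion (CyclotomicField m ℚ)) *
          galAdicCompletionMap (sigma m w) (sigma_smul_eq_self_of_mul_coe_eq_one m p hpm w hw 𝔓₀) (Ψ x 𝔓₀) +
        galAdicCompletionMap (sigma m w) (sigma_smul_eq_self_of_mul_coe_eq_one m p hpm w hw 𝔓₀)
          (galAdicCompletionMap (sigma m w) (sigma_smul_eq_self_of_mul_coe_eq_one m p hpm w hw 𝔓₀) (Ψ x 𝔓₀)) :=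
    fun x => padicTensor_eulerTwist_apply m p (Ψ : ℚ_[p] ⊗[ℚ] CyclotomicField m ℚ →ₐ[ℚ] _) hΨ w a 𝔓₀
      (sigma_smul_eq_self_of_mul_coe_eq_one m p hpm w hw 𝔓₀) x
  -- (1) the local LHS is the semi-local LHS for `Y`
  have hL : (∀ o ∈ 𝔓₀.1.adicCompletionIntegers (CyclotomicField m ℚ),
      Algebra.trace (((Rat.HeightOneSpectrum.primesEquiv (R := 𝓞 ℚ)).symm ⟨p, Fact.out⟩).adicCompletion ℚ)
          (𝔓₀.1.adicCompletion (CyclotomicField m ℚ))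
          (((p : 𝔓₀.1.adicCompletion (CyclotomicField m ℚ)) * o -
            (a : 𝔓₀.1.adicCompletion (CyclotomicField m ℚ)) *
              galAdicCompletionMap (sigma m w) (sigma_smul_eq_self_of_mul_coe_eq_one m p hpm w hw 𝔓₀) o +
            galAdicCompletionMap (sigma m w) (sigma_smul_eq_self_of_mul_coe_eq_one m p hpm w hw 𝔓₀)
              (galAdicCompletionMap (sigma m w) (sigma_smul_eq_self_of_mul_coe_eq_one m p hpm w hw 𝔓₀) o)) *
            y) ∈
        (((Rat.HeightOneSpectrum.primesEquiv (R := 𝓞 ℚ)).symm ⟨p, Fact.out⟩).adicCompletionIntegers ℚ)) ↔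
      ∀ l ∈ cycIntLattice p m, ‖Algebra.trace ℚ_[p] (ℚ_[p] ⊗[ℚ] CyclotomicField m ℚ)
        ((∑ g : (ZMod m)ˣ, (((((p : ℕ) : MonoidAlgebra ℤ_[p] (ZMod m)ˣ) -
          MonoidAlgebra.single w (a : ℤ_[p]) + MonoidAlgebra.single (w ^ 2) (1 : ℤ_[p])).coeff g :
            ℤ_[p]) : ℚ_[p]) • Algebra.TensorProduct.map (AlgHom.id ℚ ℚ_[p])
              (sigma m g : CyclotomicField m ℚ →ₐ[ℚ] CyclotomicField m ℚ) l) * Y)‖ ≤ 1 := by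
    constructor
    · intro hloc l hl
      rw [norm_le_one_iff_adicCompletionEquiv_mem, hYdef, trace_mul_symm_single m p Ψ hΨ 𝔓₀ y, hPw]
      exact hloc _ ((mem_cycIntLattice_iff_forall_padicTensor_mem m p hpm Ψ hΨ l).mp hl 𝔓₀)
    · intro hsem o ho
      have h := hsem _ (symm_single_mem_cycIntLattice m p hpm Ψ hΨ 𝔓₀ ho)
      rw [norm_le_one_iff_adicCompletionEquiv_mem, hYdef, trace_mul_symm_single m p Ψ hΨ 𝔓₀ y, hPw,
        AlgEquiv.apply_symm_apply, Pi.single_eq_same] at h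
      exact h
  -- (2) the semi-local twisted dual for `Y`, membership read factor by factor
  have hsemi := forall_norm_trace_eulerTwist_mul_le_one_iff m p hpm w a Y
  rw [eulerTwist_mem_cycIntLattice_iff_forall_of_smul_eq m p hpm Ψ hΨ w⁻¹ hst a Y] at hsemi
  -- (3) the semi-local RHS has only the `𝔓₀` component
  have hR : (∀ 𝔓 : ((Rat.HeightOneSpectrum.primesEquiv (R := 𝓞 ℚ)).symm ⟨p, Fact.out⟩).Extension
        (𝓞 (CyclotomicField m ℚ)),
      (p : 𝔓.1.adicCompletion (CyclotomicField m ℚ)) * Ψ Y 𝔓 -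
        (a : 𝔓.1.adicCompletion (CyclotomicField m ℚ)) *
          galAdicCompletionMap (sigma m w⁻¹) (hst 𝔓) (Ψ Y 𝔓) +
        galAdicCompletionMap (sigma m w⁻¹) (hst 𝔓) (galAdicCompletionMap (sigma m w⁻¹) (hst 𝔓) (Ψ Y 𝔓)) ∈
        𝔓.1.adicCompletionIntegers (CyclotomicField m ℚ)) ↔
      (p : 𝔓₀.1.adicCompletion (CyclotomicField m ℚ)) * y -
        (a : 𝔓₀.1.adicCompletion (CyclotomicField m ℚ)) *
          galAdicCompletionMap (sigma m u) (sigma_smul_eq_self_of_coe_eq m p hpm u hu 𝔓₀) y +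
        galAdicCompletionMap (sigma m u) (sigma_smul_eq_self_of_coe_eq m p hpm u hu 𝔓₀)
          (galAdicCompletionMap (sigma m u) (sigma_smul_eq_self_of_coe_eq m p hpm u hu 𝔓₀) y) ∈
      𝔓₀.1.adicCompletionIntegers (CyclotomicField m ℚ) := by
    have hsw : ∀ z, galAdicCompletionMap (sigma m w⁻¹) (hst 𝔓₀) z =
        galAdicCompletionMap (sigma m u) (sigma_smul_eq_self_of_coe_eq m p hpm u hu 𝔓₀) z :=
      fun z => galAdicCompletionMap_congr_left (CyclotomicField m ℚ) hwu _ _ z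
    constructor
    · intro h
      have h0 := h 𝔓₀
      rw [hY, Pi.single_eq_same, hsw, hsw] at h0
      exact h0
    · intro h 𝔓
      by_cases h𝔓 : 𝔓 = 𝔓₀
      · subst h𝔓
        rw [hY, Pi.single_eq_same, hsw, hsw]
        exact h
      · rw [hY, Pi.single_eq_of_ne h𝔓, eulerTwistLoc_zero]
        exact zero_mem _
  exact hL.trans (hsemi.trans hR)

end Summit.BirchSwinnertonDyer.BirchSwinnertonDyer.Theorems.KimAtThreeSemiLocalTraceDualTwistLocalDual

end
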